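import Summits.PneNP.PneNP.Theses.PhaseTwins
import Summits.PneNP.PneNP.Theorems.PhaseTwinsPolyDepthTwinsAboveDefs
import Summits.PneNP.PneNP.Theorems.PhaseTwinsPolyDepthTwinsAboveChargeVisible
import Summits.PneNP.PneNP.Theorems.PhaseTwinsPolyDepthTwinsAboveMaxDegree
import Summits.PneNP.PneNP.Theorems.PhaseTwinsPolyDepthTwinsAboveDuplicator
import Summits.PneNP.PneNP.Theorems.PhaseTwinsPolyDepthTwinsAboveConnectorDecomp
import Summits.PneNP.PneNP.Theorems.PhaseTwinsPolyDepthTwinsAboveTseitinGap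
import Summits.PneNP.PneNP.Theorems.PolyDepthTwinsAbove.Negative.LoadBearing
import Summits.PneNP.PneNP.Theorems.PolyDepthTwinsAbove.Negative.TseitinGapCoupling
import Summits.PneNP.PneNP.Theorems.PolyDepthTwinsAbove.Negative.TseitinGapTight
import Literature.Computability.Complexity.HardcoreInapproximability
import Literature.ModelTheory.FiniteModelTheory.CFIMatchingGraphs
import Literature.ModelTheory.FiniteModelTheory.CkEquivHomCount
import Literature.ModelTheory.FiniteModelTheory.CkEquivTransfer
import Literature.ModelTheory.FiniteModelTheory.CountingWidthProofs

/-!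
# Line `mirror-glued-gadget` for crux `PhaseTwins.PolyDepthTwinsAbove` (stmt-PneNP-2719) — gen 2

Skeleton of the crux idea `mirror-glued-gadget` (crux-ideate r1 k2; triage r1-2: pass as a component /
merge ≈ `parity-wired-ports`; r1-3: fail as a separate lever — "same object as the live line's pair coupling";
both panels name the card's two genuine deltas, (a) EXACT spin symmetry and (b) LOCAL junk accounting, and that is
what this skeleton formalises). Gen 2 (planner-cruxplan-stmt-PneNP-2719-mirror-glued-gadget-g2-0, 2026-08-16)
re-cuts gen 1 (planner-…-mirror-glued-gadget-0) against the tree as it stands after p76145 / p76373 landed.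

HONEST STATUS. This is a VARIANT of the picked line `parity-wired-ports`, not an independent lever: the OBJECT is
the live line's `pwGraph R W c` (`PhaseTwinsPolyDepthTwinsAboveDefs`, p72174) — two identical Sly gadget copies
`g_{δ,0}, g_{δ,1}` per edge glued by `κ₁` same-slot `V⁺–V⁺`, `V⁻–V⁻` edges IS the card's mirror-glued gadget
`Γ_sym` (`|J| = κ₁`, the copy swap is its automorphism); the trust base is the same (`stub_slyGadgets` ≡ the
named fact `slyGadgetReduction`, VERBATIM the live line's S1) and Sly's Lemma 2.2 for the wiring is the same
obligation (`stub_connector`, VERBATIM the live line's S5 — one proof closes both); the landed stubs of the live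
line are imported as theorems (`stub_chargeVisible`, `stub_maxDegree`, `stub_duplicator`). What differs is the
ENERGY HALF. The live line's energy half (`stub_tseitinGap` p76373 + `stub_parameters` p75857 +
`twins_of_estimates`) has itself LANDED since gen 1, so for closing stmt-PneNP-2719 this line is now a SECOND,
independent proof of that half, not a fallback: both lines close the crux exactly when `stub_connector` lands and
`slyGadgetReduction` is discharged. Its distinct content — the reason it is kept as a line — is the SECTOR
DECOMPOSITION: its junk half (b) is the only aligned-sector bound that survives at constant coupling (Disproof.lean
§4d(iii)/§5(3b); the template for crux #3 `MacroscopicTwinsAbove`, stmt-PneNP-2720), while its exact anti-sector (a)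
is specific to this crux (on one Tseitin base the odd/even ratio `(S^M-D^M)/(S^M+D^M)` tends to 1 at constant `κ₂`,
whence the logarithmic `κ₂` below):

* (a) the copy swap `(δ,0,x) ↔ (δ,1,x)` is an automorphism of the glued pair AND of the base `pwBase`, so on the
  ANTI-ALIGNED sector (every canonical pair in opposite phases — the card's two spin states, EXACTLY equiprobable:
  `baseWeights_swap`, PROVED here) the wiring weight is, by the Tseitin covariance of the CFI complex
  (`pwW_anti_eq`, PROVED here from the landed `tg_cxW_shift`), a Tseitin/Ising energy `Π_w f(c_w + ∂σ(w))`,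
  `f(e) = F_e^{κ₂}`, whose partition function over a CONNECTED base is exactly solvable:
  `T(c) = 2^{E-M}((f₀+f₁)^M + (-1)^{Σc}(f₀-f₁)^M)`, odd : even charge `= (S^M - D^M) : (S^M + D^M)`
  (`stub_antiTseitin`). Sly's `(GpropA)` phase entropy `n^{6M}` (the live line's `twins_of_estimates`) never enters;
* (b) the ALIGNED sector (the card's junk states `(±,±)`) is bounded by LOCAL accounting: retract each aligned pair
  to the anti-aligned one; per pair this costs `n` (one-copy imbalance, `baseWeights_flip_le`, PROVED here from the
  landed `hardcoreZOn_pwBase_phase` + `(GpropA)`), gains `B^{-κ₁}` on the glue and perturbs only the `2κ₂`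
  complexes at the two ends of that edge (`≤ ρ_F^{2κ₂}`), so `Σ_all ≤ (1 + n B^{-κ₁} ρ_F^{2κ₂})^{E} Σ_anti`
  (`stub_alignedSector`) — the per-variable junk bound of the card and the M-INDEPENDENT coupling threshold the
  disprover measured (Disproof §4d(iii)), instead of the live line's global `κ₂(M log ρ_F + g) ≤ κ₁ log B`;
* hence LOGARITHMIC couplings `κ₂ = ⌈log(16M)/g⌉`, `κ₁ = ⌈(log n + 2κ₂ log ρ_F + log 60M)/log B⌉` and a
  parameter stub (`stub_parameters`) without the `6 n^{6M} ≤ e^{κ₂ g}` race (`k = ⌈4/θ⌉+1`).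

GEN-2 DELTA (vs gen 1, 7 stubs): gen 1's `stub_baseWeights` (S3) and `stub_antiCovariance` (S5) are DISCHARGED —
proved below as `baseWeights_swap`, `baseWeights_flip_le`, `pwW_anti_eq` from the toolkit that landed after gen 1
(`hardcoreZOn_pwBase_phase`, p76145; `tg_cxW_shift`, `tg_canonEnd_canon`, `tg_cxW_pos`, p76373) — leaving FIVE
stubs, two of them shared verbatim with the live line; the landed `Negative/*` lemmas are now imported (the farm
had not built them at gen 1); `ParityWiredPorts` names are opened explicitly (no clash when the live
`stub_connector` lands — then delete S2 here and use it).

THE COMPOSITION `PolyDepthTwinsAbove_of` is kernel-checked (no `sorry` of its own): base `base3 (zigzagParams.R m₀)`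
(3-regular `η₃`-edge-expander without half-edges, PROVED in tree), twins `pwGraph R W 0` vs `pwGraph R W 1_{w₀}`
transported to `Fin N`; degrees by the landed `stub_maxDegree`; `≡_{C^K}` by the landed `stub_duplicator` +
`CkEquiv.iso_congr` + the PROVED Dvořák bridge; the factor-2 gap by `twins_of_sectors` (PROVED here from S2–S5 and
the three proved sector lemmas).

Stubs (5): `stub_slyGadgets` (S1, XL, trust base, shared, NOT a lead target), `stub_connector` (S2, L, shared
verbatim with the live line; hardest provable-now), `stub_alignedSector` (S3, M; hardest NEW: the retraction /
fibre decomposition), `stub_antiTseitin` (S4, M; cycle-space count), `stub_parameters` (S5, M; numbers only).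

Disproof.lean used (61 KB version of 2026-08-16T02:34Z, re-read by gen 2): §1
`polyDepthTwinsAbove_false_without_threshold/_degreeLB` (LANDED `Negative/LoadBearing.lean`, p73212, imported) —
honoured at S1 (`3 ≤ Δ`, `λ_c(Δ) < λ` are its hypotheses; at `q⁺ = q⁻` everything switches off: `B = 1` in S3,
`f₀ = f₁` hence `D = 0` in S4/S5); §2 bare-CFI obstruction — not this: `κ₂` complexes per vertex inside ONE
connected expander base, gap `(S^M+D^M)/(S^M-D^M)`; §4c `tseitinGap_false_without_coupling` (LANDED
`Negative/TseitinGapCoupling.lean`, p75388, imported) — the analogue is built in: with `κ₁ = 0` the factor of S3 is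
`(1 + n ρ^{2κ₂})^E` and S5's energy inequality is unsatisfiable, so S5's formula forces `κ₁ ≥ 1`; no stub is an
instance of that max-level statement (S3 is a SUM bound with the glue factor explicit); §4c′
`tseitinGap_attained_at_reference/_constant_optimal` (LANDED `Negative/TseitinGapTight.lean`, p76061, imported) —
the reason the sector line exists: at max level `e^{κ₂ g}` is optimal and must beat `n^{6M}`, at sum level the
anti-aligned sector gives `(S^M+D^M)/(S^M-D^M)` with no entropy factor; §4d(iii)/§5(3b) — adopted as the design
of S3. No landed `Negative/*` lemma refutes an instance of S1–S5.
-/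

noncomputable section

open scoped Classical BigOperators

namespace Summit.PneNP.PneNP.Cruxes.PolyDepthTwinsAbove.MirrorGluedGadget

open Finset
open Summit.PneNP.PneNP.Cruxes.PolyDepthTwinsAbove.ParityWiredPorts (PWVert Wiring slotEmb canonEnd pwGraph
  pwBase pwPhase occP occM pairW CxVert cxGraph cxWeight cxW pwW pwPsi cxRho PWCutEstimate stub_chargeVisible
  stub_maxDegree stub_duplicator hardcoreZOn_pwBase_phase tg_cxW_pos tg_cxW_shift tg_canonEnd_canon)
open Literature.Computability.Complexity (hardcoreZOn slyPhase SlyPropA SlyPropB slyB slyM slyK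
  slyGadgetReduction one_lt_slyB sum_hardcoreZOn_fiber le_and_le_of_abs_sub_le hardcoreZOn_nonneg
  hardcoreZOn_le_independencePolynomial)
open Literature.Computability.Complexity.Expander (RotGraph)
open Literature.ModelTheory.FiniteModelTheory (CkEquiv)
open Literature.ModelTheory.FiniteModelTheory.TseitinColouring (Dart EdgeExpansion Params zigzagParams)
open Literature.ModelTheory.FiniteModelTheory.CFIMatching (bit Canon NoFixed base3 η₃ edgeExpansion_base3
  noFixed_base3 η₃_pos zmod2_eq_zero_or_one)
open Literature.Probability.LatticeModels (independencePolynomial hardCoreThreshold hardCoreThreshold_pos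
  independencePolynomial_pos)
open Literature.Combinatorics.SimpleGraph (treewidth)
open Summit.PneNP.PneNP.Theses.PhaseTwins (PolyDepthTwinsAbove)

set_option linter.unusedVariables false
set_option linter.dupNamespace false

variable {M v m κ₁ κ₂ : ℕ}

/-! ## The stubs

Vocabulary: all objects are those of `PhaseTwinsPolyDepthTwinsAboveDefs` (`PWVert`, `Wiring`, `slotEmb`,
`canonEnd`, `pwGraph`, `pwBase`, `pwPhase`, `occP/occM`, `pairW`, `cxGraph/cxWeight/cxW`, `pwW`, `pwPsi`, `cxRho`,
`PWCutEstimate`). Three recurring inline expressions (no new definitions, so stub files can be written against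
the tree today):
* ANTI-ALIGNED phase vectors `∀ δ, Canon R δ → Y (δ, 1) = !Y (δ, 0)` (the two copies of every glued pair in
  opposite phases; the card's spin states `(+,−)`/`(−,+)`);
* the LOCAL CHARGE SHIFT at `w`, `∑ i : Fin 3, if Y ((canonEnd R (w, i)).1, 0) then 0 else 1 : ZMod 2` (number of
  legs of `w` whose glued pair is in spin `(−,+)`, i.e. flipped relative to the reference `(+,−)`);
* the COPY SWAP `fun g => if g.1 = δ then Y (δ, g.2 + 1) else Y g` and the single flip `Function.update Y g (!Y g)`.
-/

/-- **S1 — Sly's phase gadgets = Sly 2010 Theorem 2.1, derandomised (GŠV16 Lemma 19; GGŠVY Lemma 5 /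
Cor. 6 for the degree covering).** VERBATIM the live line's `stub_slyGadgets` (one proof closes both): literally
the hypothesis `h21` of the tree's `slyGadgetReduction_of_gadgets`, hence EQUIVALENT to the named fact
`slyGadgetReduction` — the declared trust base of every Sly-based line on this crux (XL; NOT a lead-prover
target; the line closes stmt-PneNP-2719 unconditionally exactly when it is discharged). The mirror glue
manufactures the spin symmetry from this ASYMMETRIC fact (two copies glued through same-side ports), so no
second gadget theorem (Sly–Sun's symmetric covers) is vendored. Honours `polyDepthTwinsAbove_false_without_threshold`
/ `_false_without_degreeLB` (Negative/LoadBearing): `3 ≤ Δ` and `λ_c(Δ) < λ` are exactly its hypotheses. -/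
theorem stub_slyGadgets : ∀ Δ : ℕ, 3 ≤ Δ → ∀ lam : ℝ, hardCoreThreshold Δ < lam →
    ∃ d : ℕ, 3 ≤ d ∧ d ≤ Δ ∧ hardCoreThreshold d < lam ∧
    ∃ θ qp qm : ℝ, 0 < θ ∧ θ < 1 / 8 ∧ 0 < qm ∧ qm < qp ∧ qp < 1 ∧
      ∃ n₁ : ℕ, ∀ n : ℕ, n₁ ≤ n →
        ∃ (v : ℕ) (G : SimpleGraph (Fin v)) (Wp Wm : Finset (Fin v))
          (Vp Vm : Fin (slyM d θ n) ↪ Fin v),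
          (v : ℝ) ≤ 3 * n ∧ G.maxDegree ≤ d ∧ Disjoint Wp Wm ∧
            Disjoint (Set.range Vp) (Set.range Vm) ∧
            (∀ i, G.degree (Vp i) ≤ d - 1) ∧ (∀ i, G.degree (Vm i) ≤ d - 1) ∧
            SlyPropA G lam Wp Wm n ∧
            SlyPropB G lam Wp Wm Vp Vm qp qm ((n : ℝ) ^ (-(2 * θ))) := by
  sorry

/-- S1 is exactly what the named fact `slyGadgetReduction` provides (sanity link, PROVED). -/
example (h : slyGadgetReduction) : ∀ Δ : ℕ, 3 ≤ Δ → ∀ lam : ℝ, hardCoreThreshold Δ < lam →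
    ∃ d : ℕ, 3 ≤ d ∧ d ≤ Δ ∧ hardCoreThreshold d < lam ∧
    ∃ θ qp qm : ℝ, 0 < θ ∧ θ < 1 / 8 ∧ 0 < qm ∧ qm < qp ∧ qp < 1 ∧
      ∃ n₁ : ℕ, ∀ n : ℕ, n₁ ≤ n →
        ∃ (v : ℕ) (G : SimpleGraph (Fin v)) (Wp Wm : Finset (Fin v))
          (Vp Vm : Fin (slyM d θ n) ↪ Fin v),
          (v : ℝ) ≤ 3 * n ∧ G.maxDegree ≤ d ∧ Disjoint Wp Wm ∧
            Disjoint (Set.range Vp) (Set.range Vm) ∧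
            (∀ i, G.degree (Vp i) ≤ d - 1) ∧ (∀ i, G.degree (Vm i) ≤ d - 1) ∧
            SlyPropA G lam Wp Wm n ∧
            SlyPropB G lam Wp Wm Vp Vm qp qm ((n : ℝ) ^ (-(2 * θ))) := by
  intro Δ hΔ lam hlam
  obtain ⟨d, hd3, hdΔ, hdlam, θ, qp, qm, hθ, hθ8, hqm, hlt, hqp, hmain⟩ := h Δ hΔ lam hlam
  obtain ⟨n₁, hn₁⟩ := hmain (1 / 2) (by norm_num)
  refine ⟨d, hd3, hdΔ, hdlam, θ, qp, qm, hθ, hθ8, hqm, hlt, hqp, n₁, fun n hn => ?_⟩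
  obtain ⟨v, G, Wp, Wm, Vp, Vm, hv, hdeg, hW, hVV, hdp, hdm, hA, hB, -⟩ := hn₁ n hn
  exact ⟨v, G, Wp, Wm, Vp, Vm, hv, hdeg, hW, hVV, hdp, hdm, hA, hB⟩

/-- **S2 — Sly's Lemma 2.2 for the parity wiring.** VERBATIM the live line's `stub_connector` (one proof closes
both; HARDEST provable-now stub, L; the lead's item, parts 1–3 landed as `…ConnectorIndep/Decomp/Expect.lean`):
there is `n₀(θ, ε, q±)` such that for `n ≥ n₀`, any gadget with `(GpropA)` at `n` and `(GpropB)` with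
`δ = n^{-2θ}`, wired over any base with `6M ≤ n^{θ/4}`, satisfies `PWCutEstimate` (relative error `ε`) for every
charge vector: on `pwBase` the copies are independent, given all port patterns the glue edges are indicator
products and each complex a multilinear polynomial in the vacancy indicators of six DISTINCT ports, so by
`(GpropB)` the conditional expectation is within `(1 ± n^{-2θ})^{6M} = 1 ± ε` of its product-measure value
`pwW c Y · (1+λ)^{10Mκ₂}` (`slyCutEstimate_of_slyProps` mutatis mutandis). Only the `(cutProb)` half is used by
this line (upper bound for every `Y` under the odd charge, lower bound on the anti-aligned sector under charge 0);
`(phaseProbs)` is kept so that the statement is literally the shared one. -/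
theorem stub_connector {θ ε qp qm : ℝ} (hθ : 0 < θ) (hε : 0 < ε) (hqm : 0 < qm) (hlt : qm < qp)
    (hqp : qp < 1) :
    ∃ n₀ : ℕ, ∀ n : ℕ, n₀ ≤ n → ∀ {M v m κ₁ κ₂ : ℕ} (R : RotGraph M 3) (W : Wiring v m κ₁ κ₂) {lam : ℝ},
      0 ≤ lam → (6 * M : ℝ) ≤ (n : ℝ) ^ (θ / 4) →
        SlyPropA W.G lam W.Wp W.Wm n → SlyPropB W.G lam W.Wp W.Wm W.Vp W.Vm qp qm ((n : ℝ) ^ (-(2 * θ))) →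
          ∀ c : Fin M → ZMod 2, PWCutEstimate R W lam qp qm ε n c := by
  sorry

/-- **S3 — the aligned (junk) sector is a small perturbation of the anti-aligned one: LOCAL accounting
(delta (b) of the card; Disproof.lean §4d(iii)/§5(3b)). HARDEST NEW STUB.** For ANY nonnegative base weight
`Zb` whose one-copy flips cost at most a factor `nA`, and every charge vector,
`Σ_Y pwW(c,Y) Zb(Y) ≤ (1 + nA · B^{-κ₁} · ρ_F^{2κ₂})^{E} · Σ_{Y anti-aligned} pwW(c,Y) Zb(Y)`,
`E` = number of canonical darts (= glued pairs), `B = slyB q⁺ q⁻`, `ρ_F = cxRho`. Why true: RETRACT `Y` to the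
anti-aligned `r(Y)` by flipping copy `1` of each aligned canonical pair (`A(Y)` = aligned set); per aligned pair
the glue factor is EXACTLY `pairW(s,s) = B^{-κ₁} pairW(s,¬s)` (landed `tg_pairW_facts`:
`pairW s s · B^{κ₁} = pairW true false`, and `pairW false true = pairW true false` by `ring`), the base weight
changes by `≤ nA` per flip (`hflip`, used backwards: `Y = flip (flip Y)`), and only the complexes at the two ends
of that edge read the flipped copy (`(canonEnd R (w,i)).1 = δ` forces `(w,i) ∈ {δ, rot δ}`, no `NoFixed` needed),
each changing by at most `ρ_F` (landed `tg_cxW_bounds` + `tg_cxW_const`: every `cxW e y` lies between the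
all-`+` and the all-`−` factor, which do not depend on `e`), whence `term(Y) ≤ x^{|A(Y)|} term(r Y)`; the fibres of
`r` are `{u(Y', A) : A ⊆ canonical darts}` (bijectively: re-flip copy `1` on `A`), and `Σ_{A} x^{|A|} = (1+x)^{E}`
(`Finset.sum_pow_mul_eq_add_pow`). Size M (the fibre decomposition of a sum over phase vectors; pure finite
combinatorics over the Defs, provable today). With `κ₁ = 0` the factor is `(1 + nA ρ_F^{2κ₂})^E` — useless, as it
must be (`tseitinGap_false_without_coupling`, Disproof §4c: the glue is load-bearing). Pre-screened numerically
by gen 1 (`sector_check.py`, attached to the item: equality structure and the bound on M=2 triple edge and K₄,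
6 parameter sets). -/
theorem stub_alignedSector (R : RotGraph M 3) {lam qp qm : ℝ} (hlam : 0 ≤ lam) (hqm : 0 < qm)
    (hlt : qm < qp) (hqp : qp < 1) (κ₁ κ₂ : ℕ) (c : Fin M → ZMod 2)
    (Zb : (Dart M 3 × ZMod 2 → Bool) → ℝ) (hZb : ∀ Y, 0 ≤ Zb Y) {nA : ℝ} (hnA : 0 ≤ nA)
    (hflip : ∀ (Y : Dart M 3 × ZMod 2 → Bool) (g : Dart M 3 × ZMod 2),
      Zb (Function.update Y g (!Y g)) ≤ nA * Zb Y) :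
    ∑ Y : Dart M 3 × ZMod 2 → Bool, pwW R lam qp qm κ₁ κ₂ c Y * Zb Y ≤
      (1 + nA * (slyB qp qm)⁻¹ ^ κ₁ * cxRho lam qp qm ^ (2 * κ₂)) ^
          (univ.filter fun δ : Dart M 3 => Canon R δ).card *
        ∑ Y ∈ univ.filter (fun Y : Dart M 3 × ZMod 2 → Bool => ∀ δ, Canon R δ → Y (δ, 1) = !Y (δ, 0)),
          pwW R lam qp qm κ₁ κ₂ c Y * Zb Y := by
  sorry

/-- **S4 — the anti-aligned sector is an exactly solvable Tseitin chain (delta (a) of the card, summed half):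
odd and even charge stand in the ratio `(S^M - D^M) : (S^M + D^M)`.** For ANY `f : ZMod 2 → ℝ` and ANY base
weight `Zb` invariant under the copy swap of canonical pairs, over a 3-regular base that is an `η`-edge-expander
(hence CONNECTED: `EdgeExpansion.pos`, `CFIMatching.one_le_card_leaving`) without half-edges, and every odd
charge `c`:
`(Σ_{Y anti} Π_w f(c_w + ∂Y(w)) Zb(Y)) · (S^M + D^M) = (Σ_{Y anti} Π_w f(∂Y(w)) Zb(Y)) · (S^M − D^M)`,
`S = f 0 + f 1`, `D = f 0 − f 1`. Why true: (i) swap-invariance makes `G(σ) := Σ_{Y anti, spins σ} Zb(Y)`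
independent of the spin vector `σ ∈ Bool^{E}` (swapping pair `δ` negates `σ_δ` and permutes the free,
non-canonical entries of `Y` not at all), so both sums are `G₀ · T(c)` with `T(c) = Σ_σ Π_w f(c_w + ∂σ(w))`;
(ii) `T(c) = 2^{E−M}((f0+f1)^M + (−1)^{Σc}(f0−f1)^M)`: write `f(e) = a + b(−1)^e`, expand `Π_w` over `U ⊆ V`
(`Finset.prod_add`), and sum over `σ` first (`Finset.prod_univ_sum`): each canonical dart is read by exactly the
two legs `δ`, `rot δ` (NoFixed; landed `tg_canonEnd_canon`), so `Σ_σ (−1)^{Σ_{w∈U} ∂σ(w)} = Π_δ (1 +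
(−1)^{[δ.1∈U]+[(rot δ).1∈U]})` vanishes unless `U` has no leaving dart, i.e. `U ∈ {∅, univ}` by connectedness;
the two surviving terms give the formula, and `(S^M−D^M)(S^M+D^M)` is symmetric. Size M (the cycle-space /
high-temperature count; no real analysis; provable today over the Defs). Pre-screened numerically by gen 1
(`sector_check.py`: identity to 1e-15 on M=2 and K₄ for 3 asymmetric swap-invariant base weights). -/
theorem stub_antiTseitin {R : RotGraph M 3} (hR : NoFixed R) {η : ℝ} (hexp : EdgeExpansion R η)
    (f : ZMod 2 → ℝ) (Zb : (Dart M 3 × ZMod 2 → Bool) → ℝ)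
    (hswap : ∀ (Y : Dart M 3 × ZMod 2 → Bool) (δ : Dart M 3), Canon R δ →
      Zb (fun g => if g.1 = δ then Y (δ, g.2 + 1) else Y g) = Zb Y)
    (c : Fin M → ZMod 2) (hc : ∑ w, c w = 1) :
    (∑ Y ∈ univ.filter (fun Y : Dart M 3 × ZMod 2 → Bool => ∀ δ, Canon R δ → Y (δ, 1) = !Y (δ, 0)),
        (∏ w : Fin M, f (c w + ∑ i : Fin 3, if Y ((canonEnd R (w, i)).1, 0) then 0 else 1)) * Zb Y) *
      ((f 0 + f 1) ^ M + (f 0 - f 1) ^ M) =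
    (∑ Y ∈ univ.filter (fun Y : Dart M 3 × ZMod 2 → Bool => ∀ δ, Canon R δ → Y (δ, 1) = !Y (δ, 0)),
        (∏ w : Fin M, f (∑ i : Fin 3, if Y ((canonEnd R (w, i)).1, 0) then 0 else 1)) * Zb Y) *
      ((f 0 + f 1) ^ M - (f 0 - f 1) ^ M) := by
  sorry

/-- **S5 — the parameter regime is nonempty, with LOGARITHMIC couplings (numbers only).** Inputs:
`θ ∈ (0,1/8)`, `η > 0` (expansion), `B > 1` (glue gain), `ρ > 0` (complex range), `0 < f₁ < f₀` (the two complex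
factors), `d ≥ 3`, `D` (zig-zag degree), `N₀`. With `k := ⌈4/θ⌉+1`, `θ' := 1/(2k+2)`, `M := m₀·2(D+1)`, `n := M^k`,
`κ₂ := ⌈log(16M)/log(f₀/f₁)⌉`, `κ₁ := ⌈(log n + 2κ₂ log ρ + log(60M))/log B⌉`, `K := ⌊ηM/7⌋`, for `m₀` large:
`N₀ ≤ n`; port budget `κ₁ + 2κ₂ ≤ slyM d θ n` (logs against `n^θ/(d−1)`); connector budget `6M ≤ n^{θ/4}`
(`1/k < θ/4`); the ENERGY INEQUALITY `6 (1+x)^{3M} (Sₖ^M − Dₖ^M) ≤ Sₖ^M + Dₖ^M` with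
`x = n B^{−κ₁} ρ^{2κ₂} ≤ 1/(60M)` (so `(1+x)^{3M} ≤ e^{1/20}`; if the numerator of `κ₁` is negative, `κ₁ = 0` still
gives `x ≤ 1/(60M)`), `Sₖ = f₀^{κ₂} + f₁^{κ₂}`, `Dₖ = f₀^{κ₂} − f₁^{κ₂}`, `(Dₖ/Sₖ)^M = ((1−u)/(1+u))^M ≥ 1 − 2uM ≥ 7/8`
for `u = (f₁/f₀)^{κ₂} ≤ 1/(16M)` (so the inequality reads `6·e^{1/20}·(1/8) ≤ 15/8`); `6K < ηM`; `2 ≤ M`; `1 ≤ K`;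
`n₀ ≤ M`; and `(6Mv + 10Mκ₂)^{θ'} ≤ K` for `v ≤ 3n` (`≤ (28 M^{k+1})^{θ'} ≈ √M`). Why it might fail: it cannot
(elementary asymptotics + two Bernoulli/exp inequalities), but it fixes `θ'` and certifies that deltas (a)+(b)
remove the live line's `6n^{6M} ≤ e^{κ₂ g}` race. Size M (rpow/log/ceil bookkeeping in the style of the landed
`PhaseTwinsPolyDepthTwinsAboveParameters.lean`, whose `eventually_*` helpers can be reused). Pre-screened by gen 1
(`endtoend_check.py`: energy inequality `0.67–0.74 ≤ 1.88` in 24/24 cases). -/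
theorem stub_parameters {θ η B ρ f₀ f₁ : ℝ} (hθ : 0 < θ) (hθ8 : θ < 1 / 8) (hη : 0 < η) (hB : 1 < B)
    (hρ : 0 < ρ) (hf₁ : 0 < f₁) (hf : f₁ < f₀) {d : ℕ} (hd : 3 ≤ d) (D N₀ : ℕ) :
    ∃ θ' : ℝ, 0 < θ' ∧ ∃ k : ℕ, ∀ n₀ : ℕ, ∃ m₁ : ℕ, ∀ m₀ : ℕ, m₁ ≤ m₀ →
      ∀ M n κ₁ κ₂ K : ℕ, M = m₀ * 2 * (D + 1) → n = M ^ k →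
        κ₂ = ⌈Real.log (16 * M) / Real.log (f₀ / f₁)⌉₊ →
        κ₁ = ⌈(Real.log n + 2 * κ₂ * Real.log ρ + Real.log (60 * M)) / Real.log B⌉₊ →
        K = ⌊η * M / 7⌋₊ →
          N₀ ≤ n ∧
          Fintype.card (Fin κ₁ ⊕ (Fin 2 × Fin κ₂)) ≤ slyM d θ n ∧
          (6 * M : ℝ) ≤ (n : ℝ) ^ (θ / 4) ∧
          6 * (1 + n * B⁻¹ ^ κ₁ * ρ ^ (2 * κ₂)) ^ (3 * M) *
              ((f₀ ^ κ₂ + f₁ ^ κ₂) ^ M - (f₀ ^ κ₂ - f₁ ^ κ₂) ^ M) ≤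
            (f₀ ^ κ₂ + f₁ ^ κ₂) ^ M + (f₀ ^ κ₂ - f₁ ^ κ₂) ^ M ∧
          (2 * 3 * K : ℝ) < η * M ∧
          2 ≤ M ∧ 1 ≤ K ∧ n₀ ≤ M ∧
          ∀ v : ℕ, (v : ℝ) ≤ 3 * n → (((6 * M * v + 10 * M * κ₂ : ℕ) : ℝ)) ^ θ' ≤ K := by
  sorry

/-! ## Proved glue -/

/-- The weights are nonnegative (`λ ≥ 0`, `q± ∈ [0, 1]`). (As in the live line's skeleton.) -/
theorem pwW_nonneg (R : RotGraph M 3) {lam qp qm : ℝ} (hlam : 0 ≤ lam) (hqm0 : 0 ≤ qm) (hqm1 : qm ≤ 1)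
    (hqp0 : 0 ≤ qp) (hqp1 : qp ≤ 1) (κ₁ κ₂ : ℕ) (c : Fin M → ZMod 2) (Y : Dart M 3 × ZMod 2 → Bool) :
    0 ≤ pwW R lam qp qm κ₁ κ₂ c Y := by
  have hocc : ∀ s, 0 ≤ occP qp qm s ∧ occP qp qm s ≤ 1 ∧ 0 ≤ occM qp qm s ∧ occM qp qm s ≤ 1 := by
    intro s; cases s <;> simp [occP, occM] <;> refine ⟨?_, ?_, ?_, ?_⟩ <;> assumption
  unfold pwW
  refine mul_nonneg (Finset.prod_nonneg fun δ _ => ?_) (Finset.prod_nonneg fun w _ => pow_nonneg ?_ _)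
  · split_ifs
    · unfold pairW
      refine pow_nonneg (mul_nonneg ?_ ?_) _
      · obtain ⟨h1, h2, -, -⟩ := hocc (Y (δ, 0))
        obtain ⟨h3, h4, -, -⟩ := hocc (Y (δ, 1))
        nlinarith [mul_le_one₀ h2 h3 h4]
      · obtain ⟨-, -, h1, h2⟩ := hocc (Y (δ, 0))
        obtain ⟨-, -, h3, h4⟩ := hocc (Y (δ, 1))
        nlinarith [mul_le_one₀ h2 h3 h4]
    · exact zero_le_one
  · unfold cxW cxWeight
    refine div_nonneg (Finset.sum_nonneg fun J _ => ?_) (pow_nonneg (by linarith) _)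
    split_ifs
    · refine mul_nonneg (pow_nonneg hlam _) (Finset.prod_nonneg fun p _ => ?_)
      split_ifs
      · obtain ⟨-, h2, -, -⟩ := hocc (Y ((canonEnd R (w, p.1)).1, p.2))
        linarith
      · exact zero_le_one
    · exact le_rfl


/-- The number of canonical darts is at most the number of darts `3M`. -/
theorem card_canon_le (R : RotGraph M 3) : (univ.filter fun δ : Dart M 3 => Canon R δ).card ≤ 3 * M := by
  calc (univ.filter fun δ : Dart M 3 => Canon R δ).card ≤ (univ : Finset (Dart M 3)).card :=
        Finset.card_filter_le _ _
    _ = 3 * M := by simp [Finset.card_univ, Fintype.card_prod, Fintype.card_fin, mul_comm]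

/-! ## The sector lemmas that gen 1 filed as stubs S3/S5, now PROVED from the landed toolkit -/

/-- **Swap symmetry of the base weight (gen 1's `stub_baseWeights` (i), PROVED).** Exchanging the two copies
`g_{δ,0} ↔ g_{δ,1}` of ANY dart in the phase vector leaves `Zb(Y) = Z_{pwBase}(λ; phases = Y)` unchanged: by the
landed factorisation `hardcoreZOn_pwBase_phase` (p76145) `Zb(Y) = (1+λ)^{10Mκ₂} Π_g Z_G(Y_g)`, and the swap is a
permutation of the index set of the product. This is the EXACT equiprobability of the card's two spin states. -/
theorem baseWeights_swap (W : Wiring v m κ₁ κ₂) (lam : ℝ) (Y : Dart M 3 × ZMod 2 → Bool) (δ : Dart M 3) :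
    hardcoreZOn (pwBase M κ₂ W) lam
        (fun I => pwPhase W I = fun g => if g.1 = δ then Y (δ, g.2 + 1) else Y g) =
      hardcoreZOn (pwBase M κ₂ W) lam (fun I => pwPhase W I = Y) := by
  rw [hardcoreZOn_pwBase_phase, hardcoreZOn_pwBase_phase]
  congr 1
  have h11 : (1 : ZMod 2) + 1 = 0 := by decide
  -- the copy swap of the dart `δ`, as a permutation of the index set of the copies
  have hinv : Function.Involutive
      (fun g : Dart M 3 × ZMod 2 => if g.1 = δ then (δ, g.2 + 1) else g) := by
    rintro ⟨δ', a⟩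
    by_cases h : δ' = δ
    · subst h
      simp [add_assoc, h11]
    · simp [h]
  set e : Equiv.Perm (Dart M 3 × ZMod 2) := Function.Involutive.toPerm _ hinv with he
  have he' : ∀ g : Dart M 3 × ZMod 2,
      (if g.1 = δ then Y (δ, g.2 + 1) else Y g) = Y (e g) := by
    rintro ⟨δ', a⟩
    by_cases h : δ' = δ
    · subst h
      simp [he]
    · simp [he, h]
  calc ∏ g : Dart M 3 × ZMod 2, hardcoreZOn W.G lam
          (fun S => slyPhase W.Wp W.Wm S = if g.1 = δ then Y (δ, g.2 + 1) else Y g)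
      = ∏ g : Dart M 3 × ZMod 2, hardcoreZOn W.G lam (fun S => slyPhase W.Wp W.Wm S = Y (e g)) :=
        Finset.prod_congr rfl fun g _ => by rw [he' g]
    _ = ∏ g : Dart M 3 × ZMod 2, hardcoreZOn W.G lam (fun S => slyPhase W.Wp W.Wm S = Y g) :=
        Equiv.prod_comp e (fun g => hardcoreZOn W.G lam (fun S => slyPhase W.Wp W.Wm S = Y g))

/-- **One-copy imbalance of the base weight (gen 1's `stub_baseWeights` (ii), PROVED) — the only place `(GpropA)`
enters the line.** Flipping the phase of ONE copy multiplies `Zb` by at most `n`: in the landed factorisation only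
the factor of that copy changes, and `Z_G(s̄) ≤ Z_G ≤ n · Z_G(s)` by `SlyPropA` (`n ≥ 1`). -/
theorem baseWeights_flip_le (W : Wiring v m κ₁ κ₂) {lam : ℝ} (hlam : 0 ≤ lam) {n : ℕ} (hn : 1 ≤ n)
    (hA : SlyPropA W.G lam W.Wp W.Wm n) (Y : Dart M 3 × ZMod 2 → Bool) (g₀ : Dart M 3 × ZMod 2) :
    hardcoreZOn (pwBase M κ₂ W) lam (fun I => pwPhase W I = Function.update Y g₀ (!Y g₀)) ≤
      n * hardcoreZOn (pwBase M κ₂ W) lam (fun I => pwPhase W I = Y) := by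
  rw [hardcoreZOn_pwBase_phase, hardcoreZOn_pwBase_phase]
  set F : Bool → ℝ := fun s => hardcoreZOn W.G lam (fun S => slyPhase W.Wp W.Wm S = s) with hF
  set C : ℝ := (1 + lam) ^
    Fintype.card ((Fin M × Fin 3 × ZMod 2 × Fin κ₂) ⊕ (Fin M × (Fin 2 → ZMod 2) × Fin κ₂)) with hC
  have hnpos : (0 : ℝ) < n := by exact_mod_cast hn
  have hF0 : ∀ s, 0 ≤ F s := fun s => hardcoreZOn_nonneg _ hlam _
  -- `(GpropA)`: each phase has probability at least `1/n`, so the other phase costs at most a factor `n`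
  have hflip : ∀ s : Bool, F (!s) ≤ n * F s := by
    intro s
    have h1 : F (!s) ≤ independencePolynomial W.G lam := hardcoreZOn_le_independencePolynomial _ hlam _
    have h2 : independencePolynomial W.G lam / n ≤ F s := by
      cases s
      · exact hA.2
      · exact hA.1
    rw [div_le_iff₀ hnpos] at h2
    calc F (!s) ≤ independencePolynomial W.G lam := h1
      _ ≤ F s * n := h2
      _ = n * F s := mul_comm _ _
  -- split off the factor of the flipped copy; the other factors are unchanged
  have hsplit : ∀ Z : Dart M 3 × ZMod 2 → Bool,
      ∏ g, F (Z g) = F (Z g₀) * ∏ g ∈ univ.erase g₀, F (Z g) := fun Z =>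
    (Finset.mul_prod_erase (univ : Finset (Dart M 3 × ZMod 2)) (fun g => F (Z g)) (Finset.mem_univ g₀)).symm
  have hrest : ∏ g ∈ univ.erase g₀, F (Function.update Y g₀ (!Y g₀) g) = ∏ g ∈ univ.erase g₀, F (Y g) :=
    Finset.prod_congr rfl fun g hg => by rw [Function.update_of_ne (Finset.ne_of_mem_erase hg)]
  have hC0 : 0 ≤ C := pow_nonneg (by linarith) _
  have hP0 : 0 ≤ ∏ g ∈ univ.erase g₀, F (Y g) := Finset.prod_nonneg fun g _ => hF0 _
  show C * ∏ g, F (Function.update Y g₀ (!Y g₀) g) ≤ n * (C * ∏ g, F (Y g))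
  rw [hsplit (Function.update Y g₀ (!Y g₀)), hsplit Y, hrest, Function.update_self]
  calc C * (F (!Y g₀) * ∏ g ∈ univ.erase g₀, F (Y g))
      ≤ C * (n * F (Y g₀) * ∏ g ∈ univ.erase g₀, F (Y g)) :=
        mul_le_mul_of_nonneg_left (mul_le_mul_of_nonneg_right (hflip (Y g₀)) hP0) hC0
    _ = n * (C * (F (Y g₀) * ∏ g ∈ univ.erase g₀, F (Y g))) := by ring

/-- **Tseitin covariance of the parity connector (gen 1's `stub_antiCovariance`, PROVED): on the anti-aligned
sector the wiring weight is a Tseitin energy (delta (a) of the card, pointwise half).** Over a base without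
half-edges every leg `(w, i)` reads a CANONICAL glued pair (landed `tg_canonEnd_canon`), so for an anti-aligned
`Y` the six phases seen by the complex at `w` are the reference pattern `(+,−)` with the legs in spin `(−,+)`
FLIPPED, i.e. shifted by the bits `β_i = [Y(δ_i, 0) = −]`; by the landed covariance `tg_cxW_shift`
(`cxGraph e ≅ cxGraph (e + Σβ)`) the factor is `cxW (c w + Σ_i β_i) ref`; and every glued pair in opposite phases
contributes exactly `(1-q⁺q⁻)(1-q⁻q⁺)` per pair edge couple. -/
theorem pwW_anti_eq (R : RotGraph M 3) (hR : NoFixed R) (lam qp qm : ℝ) (κ₁ κ₂ : ℕ)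
    (c : Fin M → ZMod 2) (Y : Dart M 3 × ZMod 2 → Bool)
    (hY : ∀ δ, Canon R δ → Y (δ, 1) = !Y (δ, 0)) :
    pwW R lam qp qm κ₁ κ₂ c Y =
      (((1 - qp * qm) * (1 - qm * qp)) ^ κ₁) ^ (univ.filter fun δ : Dart M 3 => Canon R δ).card *
        ∏ w : Fin M, cxW lam qp qm (c w + ∑ i : Fin 3, if Y ((canonEnd R (w, i)).1, 0) then 0 else 1)
          (fun p => decide (p.2 = 0)) ^ κ₂ := by
  have h10 : (1 : ZMod 2) ≠ 0 := by decide
  have h11 : (1 : ZMod 2) + 1 = 0 := by decide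
  -- every anti-aligned pair carries the same pair factor
  have hPt : occP qp qm true = qp := by simp [occP]
  have hPf : occP qp qm false = qm := by simp [occP]
  have hMt : occM qp qm true = qm := by simp [occM]
  have hMf : occM qp qm false = qp := by simp [occM]
  have hpair : ∀ s : Bool, pairW qp qm κ₁ s (!s) = ((1 - qp * qm) * (1 - qm * qp)) ^ κ₁ := by
    intro s
    cases s
    · show ((1 - occP qp qm false * occP qp qm true) * (1 - occM qp qm false * occM qp qm true)) ^ κ₁ = _
      rw [hPt, hPf, hMt, hMf]
      ring
    · show ((1 - occP qp qm true * occP qp qm false) * (1 - occM qp qm true * occM qp qm false)) ^ κ₁ = _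
      rw [hPt, hPf, hMt, hMf]
  unfold pwW
  congr 1
  · -- the pair product
    calc (∏ δ : Dart M 3, if Canon R δ then pairW qp qm κ₁ (Y (δ, 0)) (Y (δ, 1)) else 1)
        = ∏ δ : Dart M 3, if Canon R δ then ((1 - qp * qm) * (1 - qm * qp)) ^ κ₁ else 1 :=
          Finset.prod_congr rfl fun δ _ => by
            by_cases hδ : Canon R δ
            · rw [if_pos hδ, if_pos hδ, hY δ hδ, hpair]
            · rw [if_neg hδ, if_neg hδ]
      _ = (((1 - qp * qm) * (1 - qm * qp)) ^ κ₁) ^ (univ.filter fun δ : Dart M 3 => Canon R δ).card := by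
          rw [Finset.prod_ite, Finset.prod_const_one, mul_one, Finset.prod_const]
  · -- the complex product: Tseitin covariance, complex by complex
    refine Finset.prod_congr rfl fun w _ => ?_
    congr 1
    rw [← tg_cxW_shift lam qp qm (c w) (fun i => if Y ((canonEnd R (w, i)).1, 0) then 0 else 1)
      (fun q => decide (q.2 = 0))]
    congr 1
    funext ⟨i, a⟩
    have hcan := hY _ (tg_canonEnd_canon hR (w, i)).1
    rcases zmod2_eq_zero_or_one a with rfl | rfl <;>
      by_cases h : Y ((canonEnd R (w, i)).1, 0) = true <;> simp [h, h10, h11, hcan]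

/-- **The factor-2 gap from the sector decomposition** (PROVED; replaces the live line's `twins_of_estimates`):
from the two `PWCutEstimate`s (relative error `1/2`), the base-weight symmetries (`baseWeights_swap`,
`baseWeights_flip_le`), the aligned-sector bound S3, the anti-sector covariance (`pwW_anti_eq`) and Tseitin ratio
S4, and the energy inequality of S5,
`2 · Z(pwGraph 1_{w₀}) ≤ Z(pwGraph 0)`:
`Z(1_{w₀}) ≤ (3/2) Σ_Y pwW Zb ≤ (3/2)(1+x)^{3M} P₀ T(1_{w₀})` and `Z(0) ≥ (1/2) Σ_anti pwW Zb = (1/2) P₀ T(0)`,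
with `T(1_{w₀}) (S^M + D^M) = T(0) (S^M − D^M)` and `6 (1+x)^{3M} (S^M − D^M) ≤ S^M + D^M`. -/
theorem twins_of_sectors (R : RotGraph M 3) (hNF : NoFixed R) {η : ℝ} (hexp : EdgeExpansion R η)
    (W : Wiring v m κ₁ κ₂) {lam qp qm : ℝ} (hlam : 0 < lam) (hqm : 0 < qm) (hlt : qm < qp) (hqp : qp < 1)
    {n : ℕ} (hn : 1 ≤ n) (hA : SlyPropA W.G lam W.Wp W.Wm n) (w₀ : Fin M)
    (hc : PWCutEstimate R W lam qp qm (1 / 2) n 0)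
    (hc' : PWCutEstimate R W lam qp qm (1 / 2) n (Pi.single w₀ 1))
    (hpar : 6 * (1 + n * (slyB qp qm)⁻¹ ^ κ₁ * cxRho lam qp qm ^ (2 * κ₂)) ^ (3 * M) *
        ((cxW lam qp qm 0 (fun p => decide (p.2 = 0)) ^ κ₂ + cxW lam qp qm 1 (fun p => decide (p.2 = 0)) ^ κ₂) ^ M -
          (cxW lam qp qm 0 (fun p => decide (p.2 = 0)) ^ κ₂ - cxW lam qp qm 1 (fun p => decide (p.2 = 0)) ^ κ₂) ^ M) ≤
      (cxW lam qp qm 0 (fun p => decide (p.2 = 0)) ^ κ₂ + cxW lam qp qm 1 (fun p => decide (p.2 = 0)) ^ κ₂) ^ M +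
        (cxW lam qp qm 0 (fun p => decide (p.2 = 0)) ^ κ₂ - cxW lam qp qm 1 (fun p => decide (p.2 = 0)) ^ κ₂) ^ M) :
    2 * independencePolynomial (pwGraph R W (Pi.single w₀ 1)) lam ≤
      independencePolynomial (pwGraph R W 0) lam := by
  -- notation
  set c₁ : Fin M → ZMod 2 := Pi.single w₀ 1 with hc₁def
  set Zb : (Dart M 3 × ZMod 2 → Bool) → ℝ :=
    fun Y => hardcoreZOn (pwBase M κ₂ W) lam (fun I => pwPhase W I = Y) with hZbdef
  set f₀ : ℝ := cxW lam qp qm 0 (fun p => decide (p.2 = 0)) with hf₀def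
  set f₁ : ℝ := cxW lam qp qm 1 (fun p => decide (p.2 = 0)) with hf₁def
  set x : ℝ := n * (slyB qp qm)⁻¹ ^ κ₁ * cxRho lam qp qm ^ (2 * κ₂) with hxdef
  set anti : Finset (Dart M 3 × ZMod 2 → Bool) :=
    univ.filter (fun Y : Dart M 3 × ZMod 2 → Bool => ∀ δ, Canon R δ → Y (δ, 1) = !Y (δ, 0)) with hantidef
  set P₀ : ℝ := (((1 - qp * qm) * (1 - qm * qp)) ^ κ₁) ^ (univ.filter fun δ : Dart M 3 => Canon R δ).card
    with hP₀def
  set T₁ : ℝ := ∑ Y ∈ anti, (∏ w : Fin M, cxW lam qp qm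
      (c₁ w + ∑ i : Fin 3, if Y ((canonEnd R (w, i)).1, 0) then 0 else 1)
      (fun p => decide (p.2 = 0)) ^ κ₂) * Zb Y with hT₁def
  set T₀ : ℝ := ∑ Y ∈ anti, (∏ w : Fin M, cxW lam qp qm
      (∑ i : Fin 3, if Y ((canonEnd R (w, i)).1, 0) then 0 else 1)
      (fun p => decide (p.2 = 0)) ^ κ₂) * Zb Y with hT₀def
  set Sp : ℝ := (f₀ ^ κ₂ + f₁ ^ κ₂) ^ M + (f₀ ^ κ₂ - f₁ ^ κ₂) ^ M with hSpdef
  set Sm : ℝ := (f₀ ^ κ₂ + f₁ ^ κ₂) ^ M - (f₀ ^ κ₂ - f₁ ^ κ₂) ^ M with hSmdef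
  -- basic signs
  have hZb0 : ∀ Y, 0 ≤ Zb Y := fun Y => hardcoreZOn_nonneg _ hlam.le _
  have hPw0 : ∀ (c : Fin M → ZMod 2) Y, 0 ≤ pwW R lam qp qm κ₁ κ₂ c Y := fun c Y =>
    pwW_nonneg R hlam.le hqm.le (hlt.le.trans hqp.le) (hqm.le.trans hlt.le) hqp.le κ₁ κ₂ c Y
  have hcx0 : ∀ (e : ZMod 2) (y : Fin 3 × ZMod 2 → Bool), 0 < cxW lam qp qm e y :=
    fun e y => tg_cxW_pos hlam.le hqp.le (hlt.le.trans hqp.le) e y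
  have hf₀ : 0 < f₀ := hcx0 0 _
  have hf₁ : 0 < f₁ := hcx0 1 _
  have hf₁₀ : f₁ < f₀ := by
    have h := stub_chargeVisible hlam hqm hlt hqp
    unfold pwPsi at h
    exact (Real.log_lt_log_iff hf₁ hf₀).1 h
  have hP₀ : 0 ≤ P₀ := by
    have h1 : 0 ≤ 1 - qp * qm := by nlinarith
    have h2 : 0 ≤ 1 - qm * qp := by nlinarith
    exact pow_nonneg (pow_nonneg (mul_nonneg h1 h2) _) _
  have hx0 : 0 ≤ x := by
    have hB : 0 < slyB qp qm := lt_trans zero_lt_one (one_lt_slyB hqm hlt hqp)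
    have hρ : 0 < cxRho lam qp qm := div_pos (hcx0 0 _) (hcx0 0 _)
    positivity
  have hSp : 0 < Sp := by
    have h1 : 0 ≤ f₀ ^ κ₂ - f₁ ^ κ₂ := sub_nonneg.2 (pow_le_pow_left₀ hf₁.le hf₁₀.le κ₂)
    have h2 : 0 < f₀ ^ κ₂ + f₁ ^ κ₂ := by positivity
    have h3 : 0 < (f₀ ^ κ₂ + f₁ ^ κ₂) ^ M := pow_pos h2 M
    have h4 : 0 ≤ (f₀ ^ κ₂ - f₁ ^ κ₂) ^ M := pow_nonneg h1 M
    linarith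
  have hT₀ : 0 ≤ T₀ := Finset.sum_nonneg fun Y _ =>
    mul_nonneg (Finset.prod_nonneg fun w _ => pow_nonneg (hcx0 _ _).le _) (hZb0 Y)
  have hT₁ : 0 ≤ T₁ := Finset.sum_nonneg fun Y _ =>
    mul_nonneg (Finset.prod_nonneg fun w _ => pow_nonneg (hcx0 _ _).le _) (hZb0 Y)
  -- base weights: swap symmetry and one-copy imbalance (PROVED: `baseWeights_swap`, `baseWeights_flip_le`)
  have hswap : ∀ (Y : Dart M 3 × ZMod 2 → Bool) (δ : Dart M 3),
      Zb (fun g => if g.1 = δ then Y (δ, g.2 + 1) else Y g) = Zb Y :=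
    fun Y δ => baseWeights_swap (M := M) W lam Y δ
  have hflip : ∀ (Y : Dart M 3 × ZMod 2 → Bool) (g : Dart M 3 × ZMod 2),
      Zb (Function.update Y g (!Y g)) ≤ n * Zb Y :=
    fun Y g => baseWeights_flip_le (M := M) W hlam.le hn hA Y g
  -- S3: aligned sector for the odd charge
  have hS4 : ∑ Y, pwW R lam qp qm κ₁ κ₂ c₁ Y * Zb Y ≤
      (1 + x) ^ (univ.filter fun δ : Dart M 3 => Canon R δ).card *
        ∑ Y ∈ anti, pwW R lam qp qm κ₁ κ₂ c₁ Y * Zb Y :=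
    stub_alignedSector R hlam.le hqm hlt hqp κ₁ κ₂ c₁ Zb hZb0 (Nat.cast_nonneg n) hflip
  -- Tseitin covariance (PROVED: `pwW_anti_eq`): the anti sums are `P₀ · T`
  have hA₁ : ∑ Y ∈ anti, pwW R lam qp qm κ₁ κ₂ c₁ Y * Zb Y = P₀ * T₁ := by
    rw [hT₁def, Finset.mul_sum]
    refine Finset.sum_congr rfl fun Y hY => ?_
    rw [pwW_anti_eq R hNF lam qp qm κ₁ κ₂ c₁ Y (Finset.mem_filter.1 hY).2]
    ring
  have hA₀ : ∑ Y ∈ anti, pwW R lam qp qm κ₁ κ₂ 0 Y * Zb Y = P₀ * T₀ := by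
    rw [hT₀def, Finset.mul_sum]
    refine Finset.sum_congr rfl fun Y hY => ?_
    rw [pwW_anti_eq R hNF lam qp qm κ₁ κ₂ 0 Y (Finset.mem_filter.1 hY).2]
    simp only [Pi.zero_apply, zero_add]
    ring
  -- S4: the Tseitin ratio
  have hsum : ∑ w, c₁ w = 1 := by
    rw [hc₁def, Finset.sum_eq_single w₀ (fun w _ hw => by simp [hw]) (fun h => absurd (Finset.mem_univ _) h)]
    simp
  have hS6 : T₁ * Sp = T₀ * Sm :=
    stub_antiTseitin hNF hexp (fun e => cxW lam qp qm e (fun p => decide (p.2 = 0)) ^ κ₂) Zb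
      (fun Y δ _ => hswap Y δ) c₁ hsum
  -- the energy comparison `6 (1+x)^{3M} T₁ ≤ T₀`
  have hE : (univ.filter fun δ : Dart M 3 => Canon R δ).card ≤ 3 * M := card_canon_le R
  have hpow : (1 + x) ^ (univ.filter fun δ : Dart M 3 => Canon R δ).card ≤ (1 + x) ^ (3 * M) :=
    pow_le_pow_right₀ (by linarith) hE
  have hkey : 6 * (1 + x) ^ (3 * M) * T₁ ≤ T₀ := by
    have h1 : 6 * (1 + x) ^ (3 * M) * T₁ * Sp = 6 * (1 + x) ^ (3 * M) * Sm * T₀ := by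
      rw [mul_assoc, hS6]; ring
    have h2 : 6 * (1 + x) ^ (3 * M) * Sm * T₀ ≤ Sp * T₀ := mul_le_mul_of_nonneg_right hpar hT₀
    have h3 : 6 * (1 + x) ^ (3 * M) * T₁ * Sp ≤ T₀ * Sp := by rw [h1]; linarith
    exact le_of_mul_le_mul_right h3 hSp
  -- upper bound for the odd charge
  have hup : independencePolynomial (pwGraph R W c₁) lam ≤ 3 / 2 * ((1 + x) ^ (3 * M) * (P₀ * T₁)) := by
    rw [← sum_hardcoreZOn_fiber (pwGraph R W c₁) lam (pwPhase W)]
    calc ∑ Y, hardcoreZOn (pwGraph R W c₁) lam (fun I => pwPhase W I = Y)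
        ≤ ∑ Y, (1 + 1 / 2) * (pwW R lam qp qm κ₁ κ₂ c₁ Y * Zb Y) :=
          Finset.sum_le_sum fun Y _ => (le_and_le_of_abs_sub_le (hc' Y).2).2
      _ = 3 / 2 * ∑ Y, pwW R lam qp qm κ₁ κ₂ c₁ Y * Zb Y := by
          rw [← Finset.mul_sum]; norm_num
      _ ≤ 3 / 2 * ((1 + x) ^ (univ.filter fun δ : Dart M 3 => Canon R δ).card *
            ∑ Y ∈ anti, pwW R lam qp qm κ₁ κ₂ c₁ Y * Zb Y) :=
          mul_le_mul_of_nonneg_left hS4 (by norm_num)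
      _ ≤ 3 / 2 * ((1 + x) ^ (3 * M) * ∑ Y ∈ anti, pwW R lam qp qm κ₁ κ₂ c₁ Y * Zb Y) := by
          have hs : 0 ≤ ∑ Y ∈ anti, pwW R lam qp qm κ₁ κ₂ c₁ Y * Zb Y :=
            Finset.sum_nonneg fun Y _ => mul_nonneg (hPw0 c₁ Y) (hZb0 Y)
          exact mul_le_mul_of_nonneg_left (mul_le_mul_of_nonneg_right hpow hs) (by norm_num)
      _ = 3 / 2 * ((1 + x) ^ (3 * M) * (P₀ * T₁)) := by rw [hA₁]
  -- lower bound for the even charge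
  have hlo : 1 / 2 * (P₀ * T₀) ≤ independencePolynomial (pwGraph R W 0) lam := by
    rw [← hA₀, ← sum_hardcoreZOn_fiber (pwGraph R W 0) lam (pwPhase W)]
    calc 1 / 2 * ∑ Y ∈ anti, pwW R lam qp qm κ₁ κ₂ 0 Y * Zb Y
        ≤ 1 / 2 * ∑ Y, pwW R lam qp qm κ₁ κ₂ 0 Y * Zb Y := by
          refine mul_le_mul_of_nonneg_left ?_ (by norm_num)
          exact Finset.sum_le_sum_of_subset_of_nonneg (Finset.filter_subset _ _)
            fun Y _ _ => mul_nonneg (hPw0 0 Y) (hZb0 Y)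
      _ = ∑ Y, (1 - 1 / 2) * (pwW R lam qp qm κ₁ κ₂ 0 Y * Zb Y) := by
          rw [Finset.mul_sum]; norm_num
      _ ≤ ∑ Y, hardcoreZOn (pwGraph R W 0) lam (fun I => pwPhase W I = Y) :=
          Finset.sum_le_sum fun Y _ => (le_and_le_of_abs_sub_le (hc Y).2).1
  -- combine
  have hmid : 2 * (3 / 2 * ((1 + x) ^ (3 * M) * (P₀ * T₁))) ≤ 1 / 2 * (P₀ * T₀) := by
    have := mul_le_mul_of_nonneg_left hkey hP₀
    nlinarith
  calc 2 * independencePolynomial (pwGraph R W c₁) lam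
      ≤ 2 * (3 / 2 * ((1 + x) ^ (3 * M) * (P₀ * T₁))) := mul_le_mul_of_nonneg_left hup (by norm_num)
    _ ≤ 1 / 2 * (P₀ * T₀) := hmid
    _ ≤ independencePolynomial (pwGraph R W 0) lam := hlo

/-- The independence polynomial is invariant under transport along a bijection of the vertices. (As in the

live line's skeleton.) -/
theorem independencePolynomial_map_equiv {α β : Type*} [Fintype α] [DecidableEq α] [Fintype β]
    [DecidableEq β] (G : SimpleGraph α) (e : α ≃ β) (lam : ℝ) :
    independencePolynomial (G.map e.toEmbedding) lam = independencePolynomial G lam := by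
  have hadj : ∀ a b : α, (G.map e.toEmbedding).Adj (e.toEmbedding a) (e.toEmbedding b) ↔ G.Adj a b :=
    fun a b => SimpleGraph.map_adj_apply
  have hind : ∀ I : Finset α,
      (G.map e.toEmbedding).IsIndepSet (↑(I.map e.toEmbedding) : Set β) ↔ G.IsIndepSet (↑I : Set α) := by
    intro I
    constructor
    · intro h a ha b hb hab
      have hab' : e.toEmbedding a ≠ e.toEmbedding b := fun h' => hab (e.injective h')
      have := h (Finset.mem_coe.2 (Finset.mem_map_of_mem _ (Finset.mem_coe.1 ha)))
        (Finset.mem_coe.2 (Finset.mem_map_of_mem _ (Finset.mem_coe.1 hb))) hab'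
      exact fun hG => this ((hadj a b).2 hG)
    · intro h x hx y hy hxy
      obtain ⟨a, ha, rfl⟩ := Finset.mem_map.1 (Finset.mem_coe.1 hx)
      obtain ⟨b, hb, rfl⟩ := Finset.mem_map.1 (Finset.mem_coe.1 hy)
      exact fun hG => h (Finset.mem_coe.2 ha) (Finset.mem_coe.2 hb) (fun hab => hxy (by rw [hab]))
        ((hadj a b).1 hG)
  unfold independencePolynomial
  symm
  refine Fintype.sum_equiv (Equiv.finsetCongr e) _ _ fun I => ?_
  rw [Equiv.finsetCongr_apply, Finset.card_map]
  by_cases hI : G.IsIndepSet (↑I : Set α)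
  · rw [if_pos hI, if_pos ((hind I).2 hI)]
  · rw [if_neg hI, if_neg (fun h => hI ((hind I).1 h))]

/-- Transport of a degree bound along an isomorphism, for ANY decidability instances. -/
theorem maxDegree_le_of_iso {α β : Type*} [Fintype α] [Fintype β] {G : SimpleGraph α} {H : SimpleGraph β}
    {iG : DecidableRel G.Adj} {iH : DecidableRel H.Adj} (f : G ≃g H) {Δ : ℕ}
    (h : @SimpleGraph.maxDegree α G _ iG ≤ Δ) : @SimpleGraph.maxDegree β H _ iH ≤ Δ := by
  have := f.maxDegree_eq
  rw [← this]; exact h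

/-- The route's inlined sum IS `independencePolynomial`, for ANY decidability instances. -/
theorem indepSum_eq {α : Type*} [Fintype α] [DecidableEq α] (G : SimpleGraph α) {iG : DecidableRel G.Adj}
    {dI : ∀ I : Finset α, Decidable (G.IsIndepSet (↑I : Set α))} (lam : ℝ) :
    (∑ I : Finset α, @ite ℝ (G.IsIndepSet (↑I : Set α)) (dI I) (lam ^ I.card) 0) =
      @independencePolynomial α _ _ G iG ℝ _ lam := by
  unfold independencePolynomial
  exact Finset.sum_congr rfl fun I _ => by congr

/-- The number of vertices of the parity-wired graph. -/
theorem card_PWVert (M v κ₂ : ℕ) : Fintype.card (PWVert M v κ₂) = 6 * M * v + 10 * M * κ₂ := by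
  simp only [PWVert, Fintype.card_sum, Fintype.card_prod, Fintype.card_fin, ZMod.card, Fintype.card_fun]
  ring

/-! ## The composition (kernel-checked, no `sorry` of its own) -/

/-- **`PolyDepthTwinsAbove` from the five stubs** (plus the landed theorems `stub_chargeVisible`,
`stub_maxDegree`, `stub_duplicator` of the live line and the three sector lemmas proved above).
Given `Δ ≥ 3` and `λ > λ_c(Δ)`: S1 gives `d, θ, q±` and, for large `n`, a gadget; the landed `stub_chargeVisible`
gives `F₁ < F₀`; S5 fixes `θ'` and, for every `n₀`, logarithmic couplings `κ₁, κ₂` and parameters `M, n, K`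
satisfying all side conditions; the base is `base3 (zigzagParams.R m₀)` (`η₃`-edge-expander, no half-edges, PROVED
in tree); the twins are `pwGraph R W 0` and `pwGraph R W 1_{w₀}` transported to `Fin N`, `N = 6Mv + 10Mκ₂`:
degree by the landed `stub_maxDegree` + `Iso.maxDegree_eq`; `≡_{C^K}` by the landed `stub_duplicator` +
`CkEquiv.iso_congr`, turned into the hom-count clause for treewidth `< N^{θ'} ≤ K` by
`Dvorak2010.homCount_eq_of_ckEquiv` (PROVED bridge); the factor-2 gap by S2 (twice) + `twins_of_sectors`
(S3–S5 and the proved sector lemmas) + `independencePolynomial_map_equiv`. -/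
theorem PolyDepthTwinsAbove_of : PolyDepthTwinsAbove := by
  intro Δ hΔ lam hlam
  have hlam' : hardCoreThreshold Δ < lam := hlam
  obtain ⟨d, hd3, hdΔ, hdlam, θ, qp, qm, hθ, hθ8, hqm, hlt, hqp, nA, hnA⟩ := stub_slyGadgets Δ hΔ lam hlam'
  have hlam0 : 0 < lam := (hardCoreThreshold_pos hd3).trans hdlam
  obtain ⟨nB, hnB⟩ := stub_connector (ε := 1 / 2) hθ (by norm_num) hqm hlt hqp
  -- constants of the line
  have hη : 0 < η₃ zigzagParams.η zigzagParams.d := η₃_pos zigzagParams.η_pos zigzagParams.d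
  have hBgt : 1 < slyB qp qm := one_lt_slyB hqm hlt hqp
  have hcx0 : ∀ (e : ZMod 2) (y : Fin 3 × ZMod 2 → Bool), 0 < cxW lam qp qm e y :=
    fun e y => tg_cxW_pos hlam0.le hqp.le (hlt.le.trans hqp.le) e y
  have hρ : 0 < cxRho lam qp qm := div_pos (hcx0 0 _) (hcx0 0 _)
  have hf₁ : 0 < cxW lam qp qm 1 (fun p => decide (p.2 = 0)) := hcx0 1 _
  have hf₀ : 0 < cxW lam qp qm 0 (fun p => decide (p.2 = 0)) := hcx0 0 _
  have hf : cxW lam qp qm 1 (fun p => decide (p.2 = 0)) < cxW lam qp qm 0 (fun p => decide (p.2 = 0)) := by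
    have h := stub_chargeVisible hlam0 hqm hlt hqp
    unfold pwPsi at h
    exact (Real.log_lt_log_iff hf₁ hf₀).1 h
  obtain ⟨θ', hθ', k, hk⟩ :=
    stub_parameters hθ hθ8 hη hBgt hρ hf₁ hf hd3 zigzagParams.d (max nA nB)
  refine ⟨θ', hθ', fun n₀ => ?_⟩
  obtain ⟨m₁, hm₁⟩ := hk n₀
  -- the parameters
  let M : ℕ := m₁ * 2 * (zigzagParams.d + 1)
  let n : ℕ := M ^ k
  let κ₂ : ℕ := ⌈Real.log (16 * M) /
    Real.log (cxW lam qp qm 0 (fun p => decide (p.2 = 0)) / cxW lam qp qm 1 (fun p => decide (p.2 = 0)))⌉₊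
  let κ₁ : ℕ := ⌈(Real.log n + 2 * κ₂ * Real.log (cxRho lam qp qm) + Real.log (60 * M)) /
    Real.log (slyB qp qm)⌉₊
  let K : ℕ := ⌊η₃ zigzagParams.η zigzagParams.d * M / 7⌋₊
  obtain ⟨h1, h2, h3, h4, h5, h6, h7, h8, h9⟩ :=
    hm₁ m₁ le_rfl M n κ₁ κ₂ K rfl rfl rfl rfl rfl
  -- the base: 3-regular η₃-edge-expander on `M` vertices without half-edges (PROVED in tree)
  let R : RotGraph M 3 := base3 (zigzagParams.R m₁)
  have hexp : EdgeExpansion R (η₃ zigzagParams.η zigzagParams.d) :=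
    edgeExpansion_base3 _ (zigzagParams.expands m₁)
  have hNF : NoFixed R := noFixed_base3 _
  have hMpos : 0 < M := by omega
  have hnpos : 0 < n := pow_pos hMpos k
  have hn1 : 1 ≤ n := hnpos
  -- the gadget at `n`
  obtain ⟨v, G, Wp, Wm, Vp, Vm, hv, hdeg, -, hVV, hdp, hdm, hA, hB⟩ :=
    hnA n ((le_max_left nA nB).trans h1)
  -- the wiring and the two graphs
  let W : Wiring v (slyM d θ n) κ₁ κ₂ := ⟨G, Wp, Wm, Vp, Vm, slotEmb h2⟩
  let w₀ : Fin M := ⟨0, hMpos⟩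
  let X : SimpleGraph (PWVert M v κ₂) := pwGraph R W 0
  let X' : SimpleGraph (PWVert M v κ₂) := pwGraph R W (Pi.single w₀ 1)
  let N : ℕ := Fintype.card (PWVert M v κ₂)
  have hNcard : N = 6 * M * v + 10 * M * κ₂ := card_PWVert M v κ₂
  let e : PWVert M v κ₂ ≃ Fin N := Fintype.equivFin (PWVert M v κ₂)
  -- the estimates
  have hcut0 : PWCutEstimate R W lam qp qm (1 / 2) n 0 :=
    hnB n ((le_max_right nA nB).trans h1) R W hlam0.le h3 hA hB 0
  have hcut1 : PWCutEstimate R W lam qp qm (1 / 2) n (Pi.single w₀ 1) :=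
    hnB n ((le_max_right nA nB).trans h1) R W hlam0.le h3 hA hB _
  have htwins : 2 * independencePolynomial X' lam ≤ independencePolynomial X lam :=
    twins_of_sectors R hNF hexp W hlam0 hqm hlt hqp hn1 hA w₀ hcut0 hcut1 h4
  have hck : CkEquiv K X X' := stub_duplicator hexp h6 W 0 (Pi.single w₀ 1) h5
  have hdegX : X.maxDegree ≤ Δ := stub_maxDegree R W 0 hΔ hdΔ hdeg hVV hdp hdm
  have hdegX' : X'.maxDegree ≤ Δ := stub_maxDegree R W _ hΔ hdΔ hdeg hVV hdp hdm
  refine ⟨N, X.map e.toEmbedding, X'.map e.toEmbedding, ?_, ?_, ?_, ?_, ?_⟩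
  · -- order `≥ n₀`
    have hκ₂ : 1 ≤ κ₂ := by
      refine Nat.one_le_iff_ne_zero.2 fun h0 => ?_
      have hk0 : Real.log (16 * M) /
          Real.log (cxW lam qp qm 0 (fun p => decide (p.2 = 0)) /
            cxW lam qp qm 1 (fun p => decide (p.2 = 0))) ≤ 0 := Nat.ceil_eq_zero.1 h0
      have hM2 : (2 : ℝ) ≤ M := by exact_mod_cast h6
      have hnum : 0 < Real.log (16 * M) := Real.log_pos (by linarith)
      have hden : 0 < Real.log (cxW lam qp qm 0 (fun p => decide (p.2 = 0)) /
          cxW lam qp qm 1 (fun p => decide (p.2 = 0))) :=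
        Real.log_pos ((one_lt_div hf₁).2 hf)
      have := div_pos hnum hden
      linarith
    have hMN : M ≤ N := by
      rw [hNcard]
      calc M = M * 1 := (mul_one M).symm
        _ ≤ 10 * M * κ₂ := Nat.mul_le_mul (Nat.le_mul_of_pos_left M (by norm_num)) hκ₂
        _ ≤ 6 * M * v + 10 * M * κ₂ := Nat.le_add_left _ _
    exact h8.trans hMN
  · -- maximum degree of the first twin
    exact maxDegree_le_of_iso (SimpleGraph.Iso.map e X) hdegX
  · -- maximum degree of the second twin
    exact maxDegree_le_of_iso (SimpleGraph.Iso.map e X') hdegX'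
  · -- homomorphism indistinguishability below treewidth `N ^ θ' ≤ K`
    intro mF F hF
    have hNK : ((N : ℕ) : ℝ) ^ θ' ≤ K := by
      rw [hNcard]; exact h9 v hv
    have hKF : (treewidth F : ℝ) < K := hF.trans_le hNK
    have hKF' : treewidth F < K := by exact_mod_cast hKF
    have hck' : CkEquiv K (X.map e.toEmbedding) (X'.map e.toEmbedding) :=
      hck.iso_congr (SimpleGraph.Iso.map e X) (SimpleGraph.Iso.map e X')
    exact Literature.ModelTheory.FiniteModelTheory.Dvorak2010.homCount_eq_of_ckEquiv h7 hck' F hKF'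
  · -- the factor-2 gap, transported to `Fin N`
    have hZ := htwins
    rw [← independencePolynomial_map_equiv X e lam, ← independencePolynomial_map_equiv X' e lam] at hZ
    convert hZ using 2 <;> exact indepSum_eq _ _

end Summit.PneNP.PneNP.Cruxes.PolyDepthTwinsAbove.MirrorGluedGadget
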